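import Summits.NavierStokesRegularity.FunctionalMining.TopEigMomentRateSup
import Summits.NavierStokesRegularity.FunctionalMining.TopEigHeatConvex
import Literature.Analysis.FunctionSpaces.TorusLerayHelmholtzProofs
import Literature.Analysis.FunctionSpaces.TorusTrigPoly
import Literature.Analysis.FunctionSpaces.TorusFourierModes
import HarnessLib

/-!
# FunctionalMining — the viscous term of the regularised `λ₁`-moment against the HEAT LINE

Search for candidate a priori estimates; no regularity claim. Cell `pub-nsfunc`, prove seat
(gen 17). Kernel support for Theorem G (ii) of SIEVELD §3.4 (`TopEigTLDOfCoercive`): the link between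
the viscous term of the balance of the regularised moment `F_φ(v) = ∫ W_φ(S_v)`
(`W_φ = (φ̃ ⋆ g + 2r)^q`, `TopEigWeight`) and the dictionary's `heatDissipation` (a supremum of
difference quotients of the NON-smooth moment along the heat line `t ↦ v + tΔv`,
`TopEigHeatCoercive.lean`). Everything is pointwise convexity — no derivative of the non-smooth
functional is taken:

* `TopEig.isDivFree_laplacian`, `TopEig.isDivFree_add_smul`, `TopEig.strainFlat_laplacian`: the heat
  line `v + tΔv` of a smooth divergence-free field is smooth and divergence free, with strain
  `S + tΔS`;
* `TopEig.fderiv_weight_le_sub` — TANGENT INEQUALITY `DW_φ(z)[w] ≤ W_φ(z + w) − W_φ(z)` whenever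
  `g ≥ 0` along the segment `[z, z + w]` (`q ≥ 1`; `W_φ` is convex there);
* `TopEig.mul_integral_fderiv_weight_laplacian_le` — hence, for an admissible-type density `g`
  (`g ≥ 0` on divergence-free strains), smooth divergence-free `v` and every real `τ`:
  `τ · ∫ DW_φ(S_v)[ΔS_v] ≤ F_φ(v + τΔv) − F_φ(v)`.

[ours; folklore convex analysis]
-/

noncomputable section

open MeasureTheory Set Filter Topology Finset
open scoped InnerProductSpace RealInnerProductSpace ContDiff

namespace Summit.NavierStokesRegularity.FunctionalMining

open Literature.Analysis.FunctionSpaces Literature.Analysis.FunctionSpaces.Torus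
  Literature.Analysis.FluidPDE

namespace TopEig

open StrainL4

/-! ## 1. The heat line of a divergence-free field -/

section DivFree

variable {d : Type*} [Fintype d] [DecidableEq d]

/-- The Laplacian of a smooth divergence-free field on `T^d` is divergence free (Fourier side:
`𝓕(Δv)(k) = −4π²|k|² v̂(k)` is transversal when `v̂(k)` is). [folklore] -/
theorem isDivFree_laplacian {v : UnitAddTorus d → EuclideanSpace ℝ d} (hv : IsSmooth v)
    (hdiv : IsDivFree v) : IsDivFree (Torus.laplacian v) := by
  -- adapted from Summits/AnomalousDissipation/.../GalerkinSteadyZerothLaw/Negative/Planar.lean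
  refine isDivFree_of_sum_mul_mFourierCoeff_eq_zero hv.laplacian fun k => ?_
  have h := hdiv.sum_mul_mFourierCoeff_eq_zero hv k
  simp_rw [mFourierCoeff_complexify_laplacian hv k, PiLp.neg_apply, PiLp.smul_apply, smul_eq_mul]
  calc ∑ j, (k j : ℂ) * -((((4 * Real.pi ^ 2 * freqNormSq k : ℝ) : ℂ)) *
          UnitAddTorus.mFourierCoeff (EuclideanSpace.complexify ∘ v) k j)
      = -((((4 * Real.pi ^ 2 * freqNormSq k : ℝ) : ℂ)) *
          ∑ j, (k j : ℂ) * UnitAddTorus.mFourierCoeff (EuclideanSpace.complexify ∘ v) k j) := by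
        rw [Finset.mul_sum, ← Finset.sum_neg_distrib]
        exact Finset.sum_congr rfl fun j _ => by ring
    _ = 0 := by rw [h, mul_zero, neg_zero]

/-- Linear combinations `v + t w` of smooth divergence-free fields are divergence free. [folklore] -/
theorem isDivFree_add_smul {v w : UnitAddTorus d → EuclideanSpace ℝ d} (hv : IsSmooth v)
    (hw : IsSmooth w) (hdv : IsDivFree v) (hdw : IsDivFree w) (t : ℝ) :
    IsDivFree (v + t • w) := by
  intro x
  have hvx := hdv x
  have hwx := hdw x
  simp only [Torus.divergence] at hvx hwx ⊢
  have hvi : ∀ i, IsContDiff 1 (fun y => v y i) := fun i => (hv.apply i).isContDiff (by simp)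
  have hwi : ∀ i, IsContDiff 1 (fun y => w y i) := fun i => (hw.apply i).isContDiff (by simp)
  have hfun : ∀ i, (fun y => (v + t • w) y i) = (fun y => v y i) + t • (fun y => w y i) := by
    intro i; funext y; simp [Pi.add_apply, Pi.smul_apply, smul_eq_mul]
  have hsplit : ∀ i, partialDeriv i (fun y => (v + t • w) y i) x =
      partialDeriv i (fun y => v y i) x + t * partialDeriv i (fun y => w y i) x := by
    intro i
    have hsm : IsContDiff 1 (t • fun y => w y i) := by
      unfold IsContDiff; exact (hwi i).const_smul t
    rw [hfun i, Torus.partialDeriv_add (hvi i) hsm, Pi.add_apply,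
      Torus.partialDeriv_const_smul (hwi i) t, Pi.smul_apply, smul_eq_mul]
  simp_rw [hsplit]
  rw [Finset.sum_add_distrib, ← Finset.mul_sum, hvx, hwx, mul_zero, add_zero]

/-- **The strain commutes with the Laplacian**: `S(Δv) = Δ(S v)` as vectors of `ℝ^{d×d}`. [folklore] -/
theorem strainFlat_laplacian {v : UnitAddTorus d → EuclideanSpace ℝ d} (hv : IsSmooth v)
    (y : UnitAddTorus d) : strainFlat (Torus.laplacian v) y = Torus.laplacian (strainFlat v) y := by
  ext p
  rw [strainFlat_apply, StrainTensor.laplacian_strainFlat_apply hv p.1 p.2 y]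

omit [DecidableEq d] in
/-- The heat line `v + tΔv` of a smooth field is smooth. [folklore] -/
theorem isSmooth_heatLine {v : UnitAddTorus d → EuclideanSpace ℝ d} (hv : IsSmooth v) (t : ℝ) :
    IsSmooth (v + t • Torus.laplacian v) :=
  hv.add (hv.laplacian.const_smul t)

/-- The strain along the heat line: `S(v + tΔv) = S(v) + t ΔS(v)`. [folklore] -/
theorem strainFlat_heatLine {v : UnitAddTorus d → EuclideanSpace ℝ d} (hv : IsSmooth v) (t : ℝ)
    (y : UnitAddTorus d) :
    strainFlat (v + t • Torus.laplacian v) y = strainFlat v y + t • Torus.laplacian (strainFlat v) y := by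
  rw [strainFlat_add_smul (hv.isContDiff (by simp)) (hv.laplacian.isContDiff (by simp)),
    strainFlat_laplacian hv]

end DivFree

/-! ## 2. The tangent inequality for the regularised weight along an admissible segment -/

section Tangent

variable {ι : Type*} [Fintype ι] (φ : ContDiffBump (0 : EuclideanSpace ℝ ι))
  {g : EuclideanSpace ℝ ι → ℝ}

/-- Convexity of `t ↦ W_φ(z + t w)` on `[0, 1]` when `g ≥ 0` along the segment (`q ≥ 1`): there
`g̃_φ ≥ r_out > 0`, and `W_φ = g̃_φ^q` is a convex non-decreasing function of the convex `g̃_φ`.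
[ours] -/
theorem convexOn_weight_segment (hconv : ConvexOn ℝ univ g) (hlip : LipschitzWith 1 g) {q : ℝ}
    (hq : 1 ≤ q) {z w : EuclideanSpace ℝ ι} (hseg : ∀ t ∈ Icc (0 : ℝ) 1, 0 ≤ g (z + t • w)) :
    ConvexOn ℝ (Icc (0 : ℝ) 1) (fun t : ℝ => weight φ g q (z + t • w)) := by
  have hgc : Continuous g := hlip.continuous
  have hq0 : 0 ≤ q := by linarith
  have hpos : ∀ t ∈ Icc (0 : ℝ) 1, 0 < lamReg φ g (z + t • w) := fun t ht =>
    (mem_posSet_of_nonneg φ hlip (hseg t ht)).1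
  refine ⟨convex_Icc 0 1, fun s hs t ht a b ha hb hab => ?_⟩
  have hst : a • s + b • t ∈ Icc (0 : ℝ) 1 := (convex_Icc (0 : ℝ) 1) hs ht ha hb hab
  simp only [smul_eq_mul] at hst ⊢
  have hX : 0 < lamReg φ g (z + s • w) := hpos s hs
  have hY : 0 < lamReg φ g (z + t • w) := hpos t ht
  have h0 : 0 < lamReg φ g (z + (a * s + b * t) • w) := hpos _ hst
  have hlin : a • (z + s • w) + b • (z + t • w) = z + (a * s + b * t) • w := by
    calc a • (z + s • w) + b • (z + t • w) = (a + b) • z + (a * s + b * t) • w := by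
          simp only [smul_add, smul_smul, add_smul]; abel
      _ = z + (a * s + b * t) • w := by rw [hab, one_smul]
  have h1 : lamReg φ g (z + (a * s + b * t) • w) ≤
      a * lamReg φ g (z + s • w) + b * lamReg φ g (z + t • w) := by
    have h := (convexOn_lamReg φ hconv hgc).2 (mem_univ (z + s • w)) (mem_univ (z + t • w)) ha hb hab
    rw [hlin] at h
    simpa only [smul_eq_mul] using h
  have h2 := (convexOn_rpow hq).2 (mem_Ici.2 hX.le) (mem_Ici.2 hY.le) ha hb hab
  simp only [smul_eq_mul] at h2
  unfold weight
  calc lamReg φ g (z + (a * s + b * t) • w) ^ q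
      ≤ (a * lamReg φ g (z + s • w) + b * lamReg φ g (z + t • w)) ^ q :=
        Real.rpow_le_rpow h0.le h1 hq0
    _ ≤ a * lamReg φ g (z + s • w) ^ q + b * lamReg φ g (z + t • w) ^ q := h2

/-- **Tangent inequality**: `DW_φ(z)[w] ≤ W_φ(z + w) − W_φ(z)` whenever `g ≥ 0` along the segment
from `z` to `z + w` (`q ≥ 1`). [ours; a convex function lies above its tangent] -/
theorem fderiv_weight_le_sub (hconv : ConvexOn ℝ univ g) (hlip : LipschitzWith 1 g) {q : ℝ}
    (hq : 1 ≤ q) {z w : EuclideanSpace ℝ ι} (hseg : ∀ t ∈ Icc (0 : ℝ) 1, 0 ≤ g (z + t • w)) :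
    fderiv ℝ (weight φ g q) z w ≤ weight φ g q (z + w) - weight φ g q z := by
  have hgc : Continuous g := hlip.continuous
  have hz : z ∈ posSet φ g := by
    have h := (mem_posSet_of_nonneg φ hlip (hseg 0 ⟨le_rfl, zero_le_one⟩)).1
    simpa using h
  -- the restriction to the segment and its derivative at `0`
  set h : ℝ → ℝ := fun t => weight φ g q (z + t • w) with hh
  have hline : HasDerivAt (fun s : ℝ => z + s • w) w 0 := by
    have h := ((hasDerivAt_id (0 : ℝ)).smul_const w).const_add z
    simpa using h
  have hWd : DifferentiableAt ℝ (weight φ g q) z :=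
    ((contDiffOn_weight φ hgc q (n := 1) (by norm_num)).differentiableOn (by simp)).differentiableAt
      ((isOpen_posSet φ hgc).mem_nhds hz)
  have hder : HasDerivAt h (fderiv ℝ (weight φ g q) z w) 0 := by
    have hz0 : z + (0 : ℝ) • w = z := by simp
    have hWd' : HasFDerivAt (weight φ g q) (fderiv ℝ (weight φ g q) z) (z + (0 : ℝ) • w) := by
      rw [hz0]; exact hWd.hasFDerivAt
    exact hWd'.comp_hasDerivAt (0 : ℝ) hline
  have hcv := convexOn_weight_segment φ hconv hlip hq hseg
  have hsl := hcv.le_slope_of_hasDerivAt (x := 0) (y := 1) ⟨le_rfl, zero_le_one⟩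
    ⟨zero_le_one, le_rfl⟩ zero_lt_one hder
  rw [slope_def_field] at hsl
  simpa [hh] using hsl

end Tangent

/-! ## 3. The viscous term against the heat line -/

section HeatLine

variable {d : Type*} [Fintype d] [DecidableEq d] [Nonempty d]
  (φ : ContDiffBump (0 : EuclideanSpace ℝ (d × d))) {g : EuclideanSpace ℝ (d × d) → ℝ}

omit [Nonempty d] in
/-- **`τ · ∫ DW_φ(S_v)[ΔS_v] ≤ F_φ(v + τΔv) − F_φ(v)`** for `g` convex, `1`-Lipschitz and non-negative on
the strains of smooth divergence-free fields, `q ≥ 1`, smooth divergence-free `v` and any real `τ`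
(the segment from `S_v(y)` to `S_v(y) + τΔS_v(y)` consists of strains of the divergence-free fields
`v + tτΔv`, so the tangent inequality applies pointwise, and is integrated). [ours] -/
theorem mul_integral_fderiv_weight_laplacian_le (hconv : ConvexOn ℝ univ g) (hlip : LipschitzWith 1 g)
    (hg0 : ∀ v : UnitAddTorus d → EuclideanSpace ℝ d, IsSmooth v → IsDivFree v →
      ∀ x, 0 ≤ g (strainFlat v x))
    {q : ℝ} (hq : 1 ≤ q) {v : UnitAddTorus d → EuclideanSpace ℝ d} (hv : IsSmooth v)
    (hdiv : IsDivFree v) (τ : ℝ) :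
    τ * ∫ y, fderiv ℝ (weight φ g q) (strainFlat v y) (Torus.laplacian (strainFlat v) y) ≤
      (∫ y, weight φ g q (strainFlat (v + τ • Torus.laplacian v) y)) -
        ∫ y, weight φ g q (strainFlat v y) := by
  have hgc : Continuous g := hlip.continuous
  have hq0 : 0 ≤ q := by linarith
  have hvτ : IsSmooth (v + τ • Torus.laplacian v) := isSmooth_heatLine hv τ
  have hS : IsSmooth (strainFlat v) := isSmooth_strainFlat hv
  -- pointwise tangent inequality
  have hpt : ∀ y, τ * fderiv ℝ (weight φ g q) (strainFlat v y) (Torus.laplacian (strainFlat v) y) ≤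
      weight φ g q (strainFlat (v + τ • Torus.laplacian v) y) - weight φ g q (strainFlat v y) := by
    intro y
    have hseg : ∀ t ∈ Icc (0 : ℝ) 1,
        0 ≤ g (strainFlat v y + t • (τ • Torus.laplacian (strainFlat v) y)) := by
      intro t _
      have e : strainFlat v y + t • (τ • Torus.laplacian (strainFlat v) y) =
          strainFlat (v + (t * τ) • Torus.laplacian v) y := by
        rw [strainFlat_heatLine hv (t * τ) y, smul_smul]
      rw [e]
      exact hg0 _ (isSmooth_heatLine hv (t * τ))
        (isDivFree_add_smul hv hv.laplacian hdiv (isDivFree_laplacian hv hdiv) (t * τ)) y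
    have h := fderiv_weight_le_sub φ hconv hlip hq hseg
    rw [map_smul, smul_eq_mul, ← strainFlat_heatLine hv τ y] at h
    exact h
  -- integrate
  have hmaps : ∀ y, strainFlat v y ∈ posSet φ g := fun y =>
    (mem_posSet_of_nonneg φ hlip (hg0 v hv hdiv y)).1
  have hW2 : ContDiffOn ℝ 2 (weight φ g q) (posSet φ g) := contDiffOn_weight φ hgc q (by norm_cast)
  have hcA : Continuous fun y =>
      fderiv ℝ (weight φ g q) (strainFlat v y) (Torus.laplacian (strainFlat v) y) :=
    ConvexWeight.continuous_fderiv_apply (isOpen_posSet φ hgc) hW2 hS hmaps hS.laplacian.continuous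
  have hc1 : Continuous fun y => weight φ g q (strainFlat (v + τ • Torus.laplacian v) y) :=
    ((contDiff_lamReg φ hgc).continuous.comp (continuous_strainFlat hvτ)).rpow_const
      fun _ => Or.inr hq0
  have hc0 : Continuous fun y => weight φ g q (strainFlat v y) :=
    ((contDiff_lamReg φ hgc).continuous.comp (continuous_strainFlat hv)).rpow_const fun _ => Or.inr hq0
  rw [← integral_const_mul, ← integral_sub hc1.integrable_unitAddTorus hc0.integrable_unitAddTorus]
  exact integral_mono (hcA.integrable_unitAddTorus.const_mul τ)
    (hc1.integrable_unitAddTorus.sub hc0.integrable_unitAddTorus) hpt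

end HeatLine

end TopEig

end Summit.NavierStokesRegularity.FunctionalMining

end
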